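import Summits.KontsevichZagierPeriods.Zeta5Search.Barrier.ConeGammaLemmaFWinBoxSound

/-!
# ζ(5) search — BARRIER: windowed Lemma F on BOXES — soundness, part 2: feature vectors, orientations and the member
# tables on a box; merged tables

HONEST FRAMING (cell `pub-zeta5`): systematic search; no irrationality claim unless kernel-certified. Theorems about the
REAL-VALUED expressions of `ConeGammaLemmaFWinBox` (feature tables applied to a function of the feature value); MODEL-side
objects under Brown–Zudilin's (28)+(30) ((28) observed, not proved) enter only through cert-2 g35's `memShape` / `winForm` in
the sequel `ConeGammaLemmaFWinBoxCert`. Nothing here is about any γ of record, the cone's sup, C2 (OPEN), S-E (CONJECTURED),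
(TD_A) or `ζ(5)`; records in print UNMOVED. Theory seat cert-2 g36 (item «WINDOWED LEMMA F ON BOXES — KERNEL»), part 3.

* `coef_pairVec`, `featVal_pairVec`, `orientB_true` / `orientB_false`, `entG_append`, `diffTab_sound`, `cntD_sound`,
  `sumTab_sound`, `fixedTab_sound`, **`memTab_sound`** (`memShape t v w g = entG T g t` on the box) and
  **`memC_eq_cntB`**; `entG_add` / `entG_const_mul` / `entG_congr_nonneg` / `entG_id_of_linOK` (linearity in `g`, and
  the vanishing of the linear part from the integer check `linOK`); `entG_insertTab` / `entG_normTab` / **`entG_subTab`**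
  (merged tables).
-/

open Finset Set MeasureTheory
open Literature.Analysis.ValidatedNumerics.NumericsMP

namespace Summit.KontsevichZagierPeriods.Zeta5Search.Barrier.ConeGamma

namespace LemmaFWinBox

open LemmaFBox (SC KT lnNat SC_pos coef featVal minNum maxNum sum8 box centre minNum_le le_maxNum)
open LemmaFWin (jT dG memShape memT memC winForm zI mem_zI)

/-! ### Feature vectors -/

/-- Coefficients of `pairVec`. -/
theorem coef_pairVec (i j : ℕ) (b : Bool) (k : Fin 8) :
    coef (pairVec i j b) k = (if (k : ℕ) = i then (1 : ℤ) else 0) + (if (k : ℕ) = j then (if b then -1 else 1) else 0) := by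
  unfold coef pairVec
  rw [List.getD_eq_getElem?_getD, List.getElem?_map, List.getElem?_range k.isLt, Option.map_some, Option.getD_some]

/-- The value of a pair feature: `x = t_i ± t_j`. -/
theorem featVal_pairVec (i j : Fin 8) (b : Bool) (t : Fin 8 → ℝ) :
    featVal (pairVec i j b) t = t i + (if b then -t j else t j) := by
  unfold featVal
  simp only [coef_pairVec, Int.cast_add, Int.cast_ite, Int.cast_one, Int.cast_zero, Int.cast_neg, add_mul,
    Finset.sum_add_distrib, ite_mul, one_mul, zero_mul, neg_mul, Fin.val_inj]
  rw [Finset.sum_ite_eq' Finset.univ i, if_pos (Finset.mem_univ _)]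
  congr 1
  cases b
  · simp only [Bool.false_eq_true, ↓reduceIte]
    rw [Finset.sum_ite_eq' Finset.univ j, if_pos (Finset.mem_univ _)]
  · simp only [↓reduceIte]
    rw [Finset.sum_ite_eq' Finset.univ j, if_pos (Finset.mem_univ _)]

/-- `pairVec i j false` is a sum. -/
theorem featVal_pairVec_add (i j : Fin 8) (t : Fin 8 → ℝ) : featVal (pairVec i j false) t = t i + t j := by
  rw [featVal_pairVec]; simp

/-- `pairVec i j true` is a difference. -/
theorem featVal_pairVec_sub (i j : Fin 8) (t : Fin 8 → ℝ) : featVal (pairVec i j true) t = t i - t j := by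
  rw [featVal_pairVec]; simp [sub_eq_add_neg]

/-- The value of a pair feature, numeral form. -/
theorem featVal_pairVec_nat {i j : ℕ} (hi : i < 8) (hj : j < 8) (b : Bool) (t : Fin 8 → ℝ) :
    featVal (pairVec i j b) t = t ⟨i, hi⟩ + (if b then -t ⟨j, hj⟩ else t ⟨j, hj⟩) :=
  featVal_pairVec ⟨i, hi⟩ ⟨j, hj⟩ b t

/-- Index bookkeeping: `Fin.succ` on `Fin 7` adds one to the value. -/
theorem succ_eq_mk (v : Fin 7) : v.succ = (⟨v.1 + 1, by omega⟩ : Fin 8) := rfl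

/-! ### Orientation on the box -/

/-- A decided orientation `some true`: `t_{i+1} ≤ t_{v+1}` on the box. -/
theorem orientB_true {lo hi : List ℕ} {i v : Fin 7} (h : orientB lo hi i v = some true) {D : ℕ} (hD : 0 < D)
    {t : Fin 8 → ℝ} (ht : t ∈ box D lo hi) : t i.succ ≤ t v.succ := by
  unfold orientB at h
  by_cases h1 : hi.getD (i.1 + 1) 0 ≤ lo.getD (v.1 + 1) 0
  · have hD' : (0 : ℝ) < D := by exact_mod_cast hD
    have a := (ht i.succ).2
    have b := (ht v.succ).1
    rw [succ_eq_mk] at a b ⊢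
    have c : ((hi.getD (i.1 + 1) 0 : ℕ) : ℝ) ≤ ((lo.getD (v.1 + 1) 0 : ℕ) : ℝ) := by exact_mod_cast h1
    exact le_of_mul_le_mul_right (a.trans (c.trans b)) hD'
  · rw [if_neg h1] at h
    by_cases h2 : hi.getD (v.1 + 1) 0 < lo.getD (i.1 + 1) 0
    · rw [if_pos h2] at h; simp at h
    · rw [if_neg h2] at h; simp at h

/-- A decided orientation `some false`: `t_{v+1} < t_{i+1}` on the box. -/
theorem orientB_false {lo hi : List ℕ} {i v : Fin 7} (h : orientB lo hi i v = some false) {D : ℕ} (hD : 0 < D)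
    {t : Fin 8 → ℝ} (ht : t ∈ box D lo hi) : t v.succ < t i.succ := by
  unfold orientB at h
  by_cases h1 : hi.getD (i.1 + 1) 0 ≤ lo.getD (v.1 + 1) 0
  · rw [if_pos h1] at h; simp at h
  · rw [if_neg h1] at h
    by_cases h2 : hi.getD (v.1 + 1) 0 < lo.getD (i.1 + 1) 0
    · have hD' : (0 : ℝ) < D := by exact_mod_cast hD
      have a := (ht v.succ).2
      have b := (ht i.succ).1
      rw [succ_eq_mk] at a b ⊢
      have c : ((hi.getD (v.1 + 1) 0 : ℕ) : ℝ) < ((lo.getD (i.1 + 1) 0 : ℕ) : ℝ) := by exact_mod_cast h2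
      exact lt_of_mul_lt_mul_right (a.trans_lt (c.trans_le b)) hD'.le
    · rw [if_neg h2] at h; simp at h

/-! ### Tables -/

/-- `entG` over a concatenation. -/
theorem entG_append (A B : List (ℤ × List ℤ)) (g : ℝ → ℝ) (t : Fin 8 → ℝ) :
    entG (A ++ B) g t = entG A g t + entG B g t := by
  induction A with
  | nil => simp [entG]
  | cons f F ih => simp [entG, ih, add_assoc]

/-- `entG` is additive in `g`. -/
theorem entG_add (F : List (ℤ × List ℤ)) (g h : ℝ → ℝ) (t : Fin 8 → ℝ) :
    entG F (fun x => g x + h x) t = entG F g t + entG F h t := by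
  induction F with
  | nil => simp [entG]
  | cons f F ih => simp only [entG, ih]; ring

/-- `entG` is subtractive in `g`. -/
theorem entG_sub (F : List (ℤ × List ℤ)) (g h : ℝ → ℝ) (t : Fin 8 → ℝ) :
    entG F (fun x => g x - h x) t = entG F g t - entG F h t := by
  induction F with
  | nil => simp [entG]
  | cons f F ih => simp only [entG, ih]; ring

/-- `entG` is homogeneous in `g`. -/
theorem entG_const_mul (F : List (ℤ × List ℤ)) (a : ℝ) (g : ℝ → ℝ) (t : Fin 8 → ℝ) :
    entG F (fun x => a * g x) t = a * entG F g t := by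
  induction F with
  | nil => simp [entG]
  | cons f F ih => simp only [entG, ih]; ring

/-- `entG` depends on `g` only through its values at the (non-negative) feature values. -/
theorem entG_congr_nonneg {F : List (ℤ × List ℤ)} {g h : ℝ → ℝ} {t : Fin 8 → ℝ}
    (hF : ∀ f ∈ F, 0 ≤ featVal f.2 t) (hgh : ∀ x, 0 ≤ x → g x = h x) : entG F g t = entG F h t := by
  induction F with
  | nil => simp [entG]
  | cons f F ih =>
    simp only [entG]
    rw [hgh _ (hF f (by simp)), ih fun f' hf' => hF f' (by simp [hf'])]

/-- The list sum that `linOK` tests, coordinate `i`, is the coefficient of `t_i` in the linear part. -/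
theorem entG_id_eq_sum (F : List (ℤ × List ℤ)) (t : Fin 8 → ℝ) :
    entG F (fun x => x) t = ∑ i : Fin 8, (((F.map fun f => f.1 * coef f.2 i).sum : ℤ) : ℝ) * t i := by
  induction F with
  | nil => simp [entG]
  | cons f F ih =>
    simp only [entG, ih, List.map_cons, List.sum_cons, Int.cast_add, Int.cast_mul, add_mul, Finset.sum_add_distrib]
    congr 1
    unfold featVal
    rw [Finset.mul_sum]
    refine Finset.sum_congr rfl fun i _ => ?_
    ring

/-- **The linear part vanishes** when the integer check `linOK` passes. -/
theorem entG_id_of_linOK {F : List (ℤ × List ℤ)} (h : linOK F = true) (t : Fin 8 → ℝ) :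
    entG F (fun x => x) t = 0 := by
  rw [entG_id_eq_sum]
  refine Finset.sum_eq_zero fun i _ => ?_
  unfold linOK at h
  rw [List.all_eq_true] at h
  have hi := h i (List.mem_range.mpr i.isLt)
  rw [decide_eq_true_eq] at hi
  rw [hi]; simp

/-- `nonnegOK` (non-strict part): every feature value is non-negative on the box. -/
theorem nonneg_of_nonnegOK {lo hi : List ℕ} {F : List (ℤ × List ℤ)} {b : Bool} (h : nonnegOK lo hi F b = true)
    {D : ℕ} (hD : 0 < D) {t : Fin 8 → ℝ} (ht : t ∈ box D lo hi) : ∀ f ∈ F, 0 ≤ featVal f.2 t := by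
  intro f hf
  unfold nonnegOK at h
  rw [List.all_eq_true] at h
  have h1 := h f hf
  simp only [Bool.and_eq_true, decide_eq_true_eq] at h1
  have hD' : (0 : ℝ) < D := by exact_mod_cast hD
  have hm : (0 : ℝ) ≤ featVal f.2 t * D := le_trans (by exact_mod_cast h1.1) (minNum_le ht f.2)
  exact nonneg_of_mul_nonneg_left hm hD'

/-- `nonnegOK` (strict part): every feature with non-zero coefficient is positive on the box. -/
theorem pos_of_nonnegOK {lo hi : List ℕ} {F : List (ℤ × List ℤ)} (h : nonnegOK lo hi F true = true)
    {f : ℤ × List ℤ} (hf : f ∈ F) (hc : f.1 ≠ 0) : 0 < minNum f.2 lo hi := by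
  unfold nonnegOK at h
  rw [List.all_eq_true] at h
  have h1 := h f hf
  simp only [Bool.and_eq_true, decide_eq_true_eq, Bool.not_true, Bool.false_or, Bool.or_eq_true] at h1
  rcases h1.2 with h2 | h2
  · exact absurd h2 hc
  · exact h2

/-- The reoriented difference entries agree with `memShape`'s summands (over any index list). -/
theorem diffTab_sound {lo hi : List ℕ} {v w : Fin 7} {D : ℕ} (hD : 0 < D) {t : Fin 8 → ℝ} (ht : t ∈ box D lo hi)
    (g : ℝ → ℝ) : ∀ (is : List (Fin 7)) {T : List (ℤ × List ℤ)}, diffTab lo hi v w is = some T →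
      entG T g t = (is.map fun i => if i = v ∨ i = w then (0 : ℝ) else
        if t i.succ ≤ t v.succ then g (t v.succ - t i.succ) else -g (t i.succ - t v.succ)).sum
  | [], T, h => by
    simp only [diffTab, Option.some.injEq] at h
    subst h; simp [entG]
  | i :: is, T, h => by
    simp only [diffTab] at h
    cases hrec : diffTab lo hi v w is with
    | none => rw [hrec] at h; simp at h
    | some T' =>
      rw [hrec] at h
      simp only at h
      have ih := diffTab_sound hD ht g is hrec
      by_cases hiv : i = v ∨ i = w
      · rw [if_pos hiv] at h
        simp only [Option.some.injEq] at h
        subst h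
        simp [List.map_cons, List.sum_cons, if_pos hiv, ih]
      · rw [if_neg hiv] at h
        cases ho : orientB lo hi i v with
        | none => rw [ho] at h; simp at h
        | some b =>
          rw [ho] at h
          cases b
          · simp only [Option.some.injEq] at h
            subst h
            have hlt := orientB_false ho hD ht
            simp only [entG, List.map_cons, List.sum_cons, if_neg hiv, if_neg (not_le.mpr hlt), ih]
            rw [show pairVec (i.1 + 1) (v.1 + 1) true = pairVec (i.succ : Fin 8) (v.succ : Fin 8) true from rfl,
              featVal_pairVec_sub]
            push_cast; ring
          · simp only [Option.some.injEq] at h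
            subst h
            have hle := orientB_true ho hD ht
            simp only [entG, List.map_cons, List.sum_cons, if_neg hiv, if_pos hle, ih]
            rw [show pairVec (v.1 + 1) (i.1 + 1) true = pairVec (v.succ : Fin 8) (i.succ : Fin 8) true from rfl,
              featVal_pairVec_sub]
            push_cast; ring

/-- The flip count over an index list agrees with `memC`'s summands (orientations decided). -/
theorem cntD_sound {lo hi : List ℕ} {v w : Fin 7} {D : ℕ} (hD : 0 < D) {t : Fin 8 → ℝ} (ht : t ∈ box D lo hi) :
    ∀ (is : List (Fin 7)) {T : List (ℤ × List ℤ)}, diffTab lo hi v w is = some T →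
      (cntD lo hi v w is : ℝ) = (is.map fun i => if i = v ∨ i = w then (0 : ℝ) else
        if t i.succ ≤ t v.succ then 0 else 1).sum
  | [], _, _ => by simp [cntD]
  | i :: is, T, h => by
    simp only [diffTab] at h
    cases hrec : diffTab lo hi v w is with
    | none => rw [hrec] at h; simp at h
    | some T' =>
      rw [hrec] at h
      simp only at h
      have ih := cntD_sound hD ht is hrec
      by_cases hiv : i = v ∨ i = w
      · simp only [cntD, if_pos hiv, List.map_cons, List.sum_cons, Nat.cast_add, ih]; simp
      · rw [if_neg hiv] at h
        cases ho : orientB lo hi i v with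
        | none => rw [ho] at h; simp at h
        | some b =>
          cases b
          · have hlt := orientB_false ho hD ht
            simp only [cntD, if_neg hiv, ho, List.map_cons, List.sum_cons, Nat.cast_add, ih,
              if_neg (not_le.mpr hlt)]
            simp
          · have hle := orientB_true ho hD ht
            simp only [cntD, if_neg hiv, ho, List.map_cons, List.sum_cons, Nat.cast_add, ih, if_pos hle]
            simp

/-- The pair-sum entries agree with `memShape`'s summands. -/
theorem sumTab_sound (v w : Fin 7) (t : Fin 8 → ℝ) (g : ℝ → ℝ) : ∀ js : List (Fin 7),
    entG (sumTab v w js) g t = -(js.map fun j => if j = v ∨ j = w then (0 : ℝ) else g (t v.succ + t j.succ)).sum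
  | [] => by simp [sumTab, entG]
  | j :: js => by
    have ih := sumTab_sound v w t g js
    by_cases hjv : j = v ∨ j = w
    · simp only [sumTab, if_pos hjv, List.map_cons, List.sum_cons, ih]; ring
    · simp only [sumTab, if_neg hjv, entG, List.map_cons, List.sum_cons, ih]
      rw [show pairVec (v.1 + 1) (j.1 + 1) false = pairVec (v.succ : Fin 8) (j.succ : Fin 8) false from rfl,
        featVal_pairVec_add]
      push_cast; ring

/-- The fixed entries. -/
theorem fixedTab_sound (t : Fin 8 → ℝ) (g : ℝ → ℝ) :
    entG fixedTab g t = (g (t 3 + t 5) + g (t 4 + t 6) + g (t 1 + t 6) + g (t 1 + t 7) + g (t 4 + t 5)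
      + g (t 2 + t 7)) - g (t 0 - t 2) - g (t 0 - t 3) := by
  have e : ∀ (i j : Fin 8) (b : Bool), pairVec (i : ℕ) (j : ℕ) b = pairVec i j b := fun _ _ _ => rfl
  simp only [fixedTab, entG]
  rw [show pairVec 3 5 false = pairVec ((3 : Fin 8) : ℕ) ((5 : Fin 8) : ℕ) false from rfl, featVal_pairVec_add,
    show pairVec 4 6 false = pairVec ((4 : Fin 8) : ℕ) ((6 : Fin 8) : ℕ) false from rfl, featVal_pairVec_add,
    show pairVec 1 6 false = pairVec ((1 : Fin 8) : ℕ) ((6 : Fin 8) : ℕ) false from rfl, featVal_pairVec_add,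
    show pairVec 1 7 false = pairVec ((1 : Fin 8) : ℕ) ((7 : Fin 8) : ℕ) false from rfl, featVal_pairVec_add,
    show pairVec 4 5 false = pairVec ((4 : Fin 8) : ℕ) ((5 : Fin 8) : ℕ) false from rfl, featVal_pairVec_add,
    show pairVec 2 7 false = pairVec ((2 : Fin 8) : ℕ) ((7 : Fin 8) : ℕ) false from rfl, featVal_pairVec_add,
    show pairVec 0 2 true = pairVec ((0 : Fin 8) : ℕ) ((2 : Fin 8) : ℕ) true from rfl, featVal_pairVec_sub,
    show pairVec 0 3 true = pairVec ((0 : Fin 8) : ℕ) ((3 : Fin 8) : ℕ) true from rfl, featVal_pairVec_sub]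
  push_cast; ring

/-- Inserting an entry adds its term. -/
theorem entG_insertTab (e : ℤ × List ℤ) (g : ℝ → ℝ) (t : Fin 8 → ℝ) : ∀ F : List (ℤ × List ℤ),
    entG (insertTab e F) g t = (e.1 : ℝ) * g (featVal e.2 t) + entG F g t
  | [] => by simp [insertTab, entG]
  | f :: F => by
    by_cases hf : f.2 = e.2
    · rw [insertTab, if_pos hf]
      simp only [entG]
      rw [hf]; push_cast; ring
    · rw [insertTab, if_neg hf]
      simp only [entG, entG_insertTab e g t F]; ring

/-- Combining duplicates does not change the value. -/
theorem entG_normTab (T : List (ℤ × List ℤ)) (g : ℝ → ℝ) (t : Fin 8 → ℝ) : entG (normTab T) g t = entG T g t := by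
  unfold normTab
  induction T with
  | nil => simp [entG]
  | cons f F ih => simp only [List.foldr_cons, entG_insertTab, entG, ih]

/-- A `Fin 7` sum is the sum over `List.finRange 7`. -/
theorem sum_fin7_eq_list (f : Fin 7 → ℝ) : ∑ i : Fin 7, f i = ((List.finRange 7).map f).sum := by
  simp [Fin.sum_univ_seven, List.finRange_succ, List.sum_cons]
  ring

/-- **Soundness of the member table**: on the box, `memShape t v w g = entG T g t` for EVERY `g`. -/
theorem memTab_sound {lo hi : List ℕ} {v w : Fin 7} {T : List (ℤ × List ℤ)} (h : memTab lo hi v w = some T)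
    {D : ℕ} (hD : 0 < D) {t : Fin 8 → ℝ} (ht : t ∈ box D lo hi) (g : ℝ → ℝ) : memShape t v w g = entG T g t := by
  unfold memTab at h
  cases hd : diffTab lo hi v w (List.finRange 7) with
  | none => rw [hd] at h; simp at h
  | some Td =>
    rw [hd] at h
    simp only [Option.some.injEq] at h
    subst h
    rw [entG_append, entG_append, entG_append, diffTab_sound hD ht g _ hd, sumTab_sound, fixedTab_sound,
      ← sum_fin7_eq_list, ← sum_fin7_eq_list]
    unfold memShape
    simp only [entG]
    rw [show pairVec 0 (v.1 + 1) false = pairVec ((0 : Fin 8) : ℕ) ((v.succ : Fin 8) : ℕ) false from rfl,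
      featVal_pairVec_add,
      show pairVec 0 (v.1 + 1) true = pairVec ((0 : Fin 8) : ℕ) ((v.succ : Fin 8) : ℕ) true from rfl,
      featVal_pairVec_sub,
      show pairVec (v.1 + 1) (w.1 + 1) false = pairVec ((v.succ : Fin 8) : ℕ) ((w.succ : Fin 8) : ℕ) false from rfl,
      featVal_pairVec_add]
    push_cast; ring

/-- **The flip count on the box**: `memC t v w = cntB lo hi v w` whenever the table exists. -/
theorem memC_eq_cntB {lo hi : List ℕ} {v w : Fin 7} {T : List (ℤ × List ℤ)} (h : memTab lo hi v w = some T)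
    {D : ℕ} (hD : 0 < D) {t : Fin 8 → ℝ} (ht : t ∈ box D lo hi) : memC t v w = (cntB lo hi v w : ℝ) := by
  unfold memTab at h
  cases hd : diffTab lo hi v w (List.finRange 7) with
  | none => rw [hd] at h; simp at h
  | some Td =>
    unfold memC cntB
    push_cast
    rw [cntD_sound hD ht _ hd, ← sum_fin7_eq_list]

/-! ### Merged tables -/

/-- Negated tables. -/
theorem entG_map_neg (B : List (ℤ × List ℤ)) (g : ℝ → ℝ) (t : Fin 8 → ℝ) :
    entG (B.map fun f => (-f.1, f.2)) g t = -entG B g t := by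
  induction B with
  | nil => simp [entG]
  | cons f F ih => simp only [List.map_cons, entG, ih]; push_cast; ring

/-- **The merged table is the difference**: `entG (subTab A B) g t = entG A g t − entG B g t`. -/
theorem entG_subTab (A B : List (ℤ × List ℤ)) (g : ℝ → ℝ) (t : Fin 8 → ℝ) :
    entG (subTab A B) g t = entG A g t - entG B g t := by
  unfold subTab
  induction A with
  | nil => simp [entG, entG_map_neg]
  | cons f F ih => simp only [List.foldr_cons, entG_insertTab, entG, ih]; ring

/-- `mergePrev` on the real side (`P_{−1} = 0`). -/
theorem entG_mergePrev (T : List (ℤ × List ℤ)) (prev : Option (List (ℤ × List ℤ))) (g : ℝ → ℝ) (t : Fin 8 → ℝ) :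
    entG (mergePrev T prev) g t = entG T g t - (match prev with | none => 0 | some P => entG P g t) := by
  cases prev with
  | none => simp [mergePrev]
  | some P => simp [mergePrev, entG_subTab]

end LemmaFWinBox

end Summit.KontsevichZagierPeriods.Zeta5Search.Barrier.ConeGamma
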